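import Summits.ABC.IUTFork.MLFGaloisStronglyCompleteUnconditional
import Literature.AnabelianGeometry.AbsoluteAnabelian.UnitKummerCyclotomeJunctionFundamentalNaturalityAll
import Literature.AnabelianGeometry.AbsoluteAnabelian.MonoidKummerMapsUnitPairTorsorProofs
import HarnessLib

/-!
# Every isomorphism of model MLF-Galois `TLG`-pairs is `±` the groupification of a UNIQUE `TM`-isomorphism
# ([AbsTopIII] Prop 3.2 (iv) + Prop 3.3 (ii) combined, unconditionally)

S. Mochizuki, *Topics in Absolute Anabelian Geometry III*, §3 (bib key `MochizukiAbsTopIII2015`): Def. 3.1 (iii)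
p. 68 (the natural functor `𝒞^MLF_TM → 𝒞^MLF_TLG`, «passing to the groupification»), Prop. 3.2 (iv) p. 72
(`Isom_TM → Isom(Π, Π*)` injective, and bijective in the corrected form), Prop. 3.3 (ii) p. 74 (`Isom_TLG → Isom(Π, Π*)`
«surjective, with fibers of cardinality two»).

abc-iut cell, layer L4 (Prop 3.3 (i)/(ii) lineage of abc-iut-w4-d009; gen 6, own small item, PROOF-ONLY).  The
tree proves, unconditionally: the `TM` lifting F-0409 `galoisIsoLiftsToTMPairIso_holds` (abc-iut-w6-d103, p445855 —
Nikolov–Segal at `G_k`), the `TM` injectivity F-0174 `pairIsoDeterminedByGalois_holds`, and the `TLG` dichotomy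
`GaloisMonoidPair.Iso.tlg_isoM_eq_or_mul_eq_one` (two `TLG`-isomorphisms over one `Π ⥲ Π*` are equal or mutually
inverse).  This file assembles them, Summits-side because F-0409's unconditional witness lives here, into the
STRUCTURE THEOREM for isomorphisms of the model `TLG`-pairs `(Π_{k₁} ↷ k̄₁^×) ⥲ (Π_{k₂} ↷ k̄₂^×)`:

* `tlgIso_map_tmPair_actionKer` — the Galois component of a `TLG`-isomorphism is admissible for the `TM`-pairs;
* `exists_tmPairIso_of_tlgIso` / `tmPairIso_isoM_unique` — it lifts to a `TM`-isomorphism `f : (Π₁ ↷ 𝒪_k̄₁^⊳) ⥲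
  (Π₂ ↷ 𝒪_k̄₂^⊳)` with the same Galois component, UNIQUE;
* **`tlgIso_isoM_eq_tlgIso_or_mul_eq_one`** — and then `φ_M = (f_M)^gp` or `φ_M · (f_M)^gp = 1`: every isomorphism
  of model `TLG`-pairs is the groupification `f.tlgIso` of a unique `TM`-isomorphism or its inverse twist
  (`…_coe` form on elements of `k̄₂`: `φ_M x = f^gp x` for all `x` or `φ_M x = (f^gp x)⁻¹` for all `x`) —
  `Isom_TLG = Isom_TM ⊔ Isom_TM · (−1)` over `Isom_𝒯𝒢(Π₁, Π₂)`.

HONEST FRAMING: OUR kernel theorems about OUR typing of refereed [AbsTopIII] (2015) material (+ the `p`-adic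
Nikolov–Segal input proved in the tree); nothing here bears on [IUTchIII] Cor. 3.12; no side is taken; nothing
asserts that abc is proved or refuted.
-/

noncomputable section

open scoped nonZeroDivisors

namespace Summit.ABC.IUTFork

open Literature.AnabelianGeometry.AbsoluteAnabelian

variable {C₁ C₂ : MLFClosure.{0}} {D₁ : ModelMLFGaloisData C₁.k C₁.K} {D₂ : ModelMLFGaloisData C₂.k C₂.K}
  (φ : GaloisMonoidPair.Iso D₁.tlgPair D₂.tlgPair)

/-- The Galois component `φ_Π : Π₁ ⥲ Π₂` of an isomorphism of model `TLG`-pairs carries the arithmetic kernel of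
`(Π₁ ↷ 𝒪_k̄₁^⊳)` onto that of `(Π₂ ↷ 𝒪_k̄₂^⊳)` (both kernels are `Ker ε_k`).
[cite: MochizukiAbsTopIII2015, Definition 3.1 (ii) p.67] -/
theorem tlgIso_map_tmPair_actionKer :
    D₁.tmPair.actionKer.map φ.isoPi.toMulEquiv.toMonoidHom = D₂.tmPair.actionKer := by
  rw [ModelMLFGaloisData.tmPair_actionKer C₁ D₁, ModelMLFGaloisData.tmPair_actionKer C₂ D₂]
  exact φ.tlg_map_ker_aug

/-- **Every isomorphism of model `TLG`-pairs has a `TM`-lift with the same Galois component** — [AbsTopIII]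
Prop. 3.2 (iv) surjectivity (F-0409, proved unconditionally in the tree via Nikolov–Segal at `G_k`) applied to
`φ_Π`. [cite: MochizukiAbsTopIII2015, Proposition 3.2 (iv) p.72] -/
theorem exists_tmPairIso_of_tlgIso : ∃ f : GaloisMonoidPair.Iso D₁.tmPair D₂.tmPair, f.isoPi = φ.isoPi :=
  galoisIsoLiftsToTMPairIso_holds (fun _ => True) D₁.tmPair D₂.tmPair (isMLFGaloisMonoidPair_tmPair C₁ D₁)
    (isMLFGaloisMonoidPair_tmPair C₂ D₂) trivial trivial φ.isoPi (tlgIso_map_tmPair_actionKer φ)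

/-- … and the `TM`-lift is UNIQUE (F-0174, [AbsTopIII] Prop. 3.2 (iv) injectivity).
[cite: MochizukiAbsTopIII2015, Proposition 3.2 (iv) p.72] -/
theorem tmPairIso_isoM_unique (f f' : GaloisMonoidPair.Iso D₁.tmPair D₂.tmPair) (hf : f.isoPi = φ.isoPi)
    (hf' : f'.isoPi = φ.isoPi) : f.isoM = f'.isoM :=
  pairIsoDeterminedByGalois_holds D₁.tmPair D₂.tmPair (isMLFGaloisMonoidPair_tmPair C₁ D₁)
    (isMLFGaloisMonoidPair_tmPair C₂ D₂) f f' (hf.trans hf'.symm)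

/-- **STRUCTURE THEOREM: every isomorphism `φ : (Π₁ ↷ k̄₁^×) ⥲ (Π₂ ↷ k̄₂^×)` of model MLF-Galois `TLG`-pairs is the
groupification of a unique `TM`-isomorphism `f : (Π₁ ↷ 𝒪_k̄₁^⊳) ⥲ (Π₂ ↷ 𝒪_k̄₂^⊳)` or its inverse twist** —
`φ_Π = f_Π` and (`φ_M = f.tlgIso_M` or `φ_M · f.tlgIso_M = 1` pointwise): Prop. 3.2 (iv) (lift + uniqueness) with
Prop. 3.3 (ii) («fibers of cardinality two» = the `{±1}`-orbit). [cite: MochizukiAbsTopIII2015, Proposition 3.3 (ii) p.74] -/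
theorem tlgIso_isoM_eq_tlgIso_or_mul_eq_one :
    ∃ f : GaloisMonoidPair.Iso D₁.tmPair D₂.tmPair, f.isoPi = φ.isoPi ∧
      (φ.isoM = f.tlgIso.isoM ∨ ∀ x : D₁.tlgPair.M, φ.isoM x * f.tlgIso.isoM x = 1) := by
  obtain ⟨f, hf⟩ := exists_tmPairIso_of_tlgIso φ
  refine ⟨f, hf, ?_⟩
  have hPi : φ.isoPi = f.tlgIso.isoPi :=
    ContinuousMulEquiv.ext fun g => by rw [GaloisMonoidPair.Iso.tlgIso_isoPi_apply, hf]
  exact GaloisMonoidPair.Iso.tlg_isoM_eq_or_mul_eq_one (isMLFGaloisMonoidPair_tlgPair C₁ D₁) φ f.tlgIso hPi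

/-- The same on elements of `k̄₂`: `φ_M x = f^gp x` for all `x ∈ k̄₁^×`, or `φ_M x = (f^gp x)⁻¹` for all `x`.
[cite: MochizukiAbsTopIII2015, Proposition 3.3 (ii) p.74] -/
theorem tlgIso_coe_isoM_eq_or_eq_inv :
    ∃ f : GaloisMonoidPair.Iso D₁.tmPair D₂.tmPair, f.isoPi = φ.isoPi ∧
      ((∀ x : D₁.tlgPair.M, ((φ.isoM x : D₂.tlgPair.M) : C₂.K) = ((f.tlgIso.isoM x : D₂.tlgPair.M) : C₂.K)) ∨
        ∀ x : D₁.tlgPair.M, ((φ.isoM x : D₂.tlgPair.M) : C₂.K) = (((f.tlgIso.isoM x : D₂.tlgPair.M) : C₂.K))⁻¹) := by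
  obtain ⟨f, hf, h⟩ := tlgIso_isoM_eq_tlgIso_or_mul_eq_one φ
  refine ⟨f, hf, ?_⟩
  rcases h with h | h
  · exact Or.inl fun x => by rw [h]
  · refine Or.inr fun x => ?_
    have hx := congrArg (fun m : D₂.tlgPair.M => ((m : (C₂.K)⁰) : C₂.K)) (h x)
    change ((φ.isoM x : (C₂.K)⁰) : C₂.K) * ((f.tlgIso.isoM x : (C₂.K)⁰) : C₂.K) = ((1 : (C₂.K)⁰) : C₂.K) at hx
    rw [OneMemClass.coe_one] at hx
    exact eq_inv_of_mul_eq_one_left hx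

/-- **The fibre over an admissible `Π₁ ⥲ Π₂`, completely described**: for `TLG`-isomorphisms `φ, φ'` of model pairs
with the same Galois component, and THE `TM`-lift `f` of that component, each of `φ_M, φ'_M` is `f^gp_M` or its
inverse twist — so `Isom_TLG` over `φ_Π` is `{f^gp, f^gp · (−1)}` (cardinality two: Prop. 3.3 (ii)), with `f^gp` the
member preserving `𝒪^⊳`. [cite: MochizukiAbsTopIII2015, Proposition 3.3 (ii) p.74] -/
theorem tlgIso_isoM_eq_or_mul_eq_one_of_tmPairIso (f : GaloisMonoidPair.Iso D₁.tmPair D₂.tmPair)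
    (hf : f.isoPi = φ.isoPi) :
    φ.isoM = f.tlgIso.isoM ∨ ∀ x : D₁.tlgPair.M, φ.isoM x * f.tlgIso.isoM x = 1 := by
  have hPi : φ.isoPi = f.tlgIso.isoPi :=
    ContinuousMulEquiv.ext fun g => by rw [GaloisMonoidPair.Iso.tlgIso_isoPi_apply, hf]
  exact GaloisMonoidPair.Iso.tlg_isoM_eq_or_mul_eq_one (isMLFGaloisMonoidPair_tlgPair C₁ D₁) φ f.tlgIso hPi

end Summit.ABC.IUTFork

end
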